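import Summits.HodgeConjecture.HodgeConjecture.Theses.PadicSemiregularLift
import Literature.AlgebraicGeometry.KTheory.PullbackVectorBundle

/-!
# `FormalVectorBundlesAlgebraize` (stmt-HodgeConjecture-14106) · Negative · restriction to the special fibre is not faithful

A natural strengthening of crux P3a of route `PadicSemiregularLift`, REFUTED sorry-free by the standing
disprover (refuter-cdisprove-stmt-HodgeConjecture-14106-g2-0, cycle 2, 2026-08-16; work file
`Cruxes/FormalVectorBundlesAlgebraize/Disproof.lean` §7).

The crux is the essential-surjectivity half of Grothendieck's existence theorem (formal GAGA,
`Coh(𝒳) ≃ Coh(𝔛)` for `𝒳` proper over `W(k)`), for vector bundles, with the formal scheme `𝔛` seen only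
through its first level (`LevelOneForm.crux_iff_levelOne`). Replacing `𝔛` by the SPECIAL FIBRE `X_k` in
the full-faithfulness half gives the statement "restriction of endomorphisms of vector bundles from a
proper `W(k)`-scheme to `X_k` is faithful" — which is FALSE:

* `not_restrictSpecial_faithful` — witness `p = 2`, `k = 𝔽₂`, `𝒳 = Spec W(𝔽₂)` over itself (proper),
  `F = 𝒪` (a vector bundle), `f = 2 · id`, `g = 0`: `f|_{X_k} = g|_{X_k} = 0` but `f ≠ g`.

Infrastructure (all proved): `natCast_sections_eq_zero(_of_eq_zero)` and `nsmul_id_eq_zero(_of_eq_zero)`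
(`r · id_M = 0` for every module `M` over an `R`-scheme with `r = 0` in `R`; `p` on a `k`-scheme),
`natCast_prime_pow_eq_zero_wittQuot`, `pow_nsmul_id_eq_zero_thickening` (`pⁿ · id = 0` on modules over
`X_n = 𝒳 ⊗ W/pⁿ`), `nsmul_app`, `isFiniteLocallyFree_of_iso`,
`isFiniteLocallyFree_free`, `isFiniteLocallyFree_unit` (`𝒪` is a vector bundle), the model `specW` /
`trivialLine` (`Spec W(k)` over itself with `𝒪`), and `nsmul_id_trivialLine_ne_zero` (`p · id_𝒪 ≠ 0`
on `Spec W(k)`, from Mathlib `WittVector.p_nonzero` and `Scheme.ΓSpecIso`). Moral for provers: the isomorphism `F|_{X_k} ≅ E₁` in `LiftsTo` is never canonical and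
no argument may descend MORPHISMS from `X_k`; only the whole formal tower rigidifies (compare the paper
witness `not_uniqueAlgebraization` of the work file: restriction to `X_k` is not injective on
isomorphism classes either).

References: A. Grothendieck, EGA III₁ (1961), Thm 5.1.4; U. Görtz, T. Wedhorn, *Algebraic Geometry II*
(2023), Thm 24.94.
-/

-- `Summit.HodgeConjecture.HodgeConjecture.…` is the prescribed namespace of a single-conjunct summit (D-0017).
set_option linter.dupNamespace false

namespace Summit.HodgeConjecture.HodgeConjecture.Theorems.FormalVectorBundlesAlgebraize.Negative

open CategoryTheory AlgebraicGeometry Limits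
open Literature.AlgebraicGeometry.Motives Literature.AlgebraicGeometry.Motives.WittScheme
open Literature.AlgebraicGeometry.KTheory

noncomputable section

universe u

section CharP

/-- Over an `R`-scheme, a natural number that vanishes in `R` vanishes in every ring of sections.
[folklore] -/
theorem natCast_sections_eq_zero_of_eq_zero {R : Type u} [CommRing R] {r : ℕ} (hr : (r : R) = 0)
    {Y : Scheme.{u}} (f : Y ⟶ Spec (.of R)) (U : Y.Opens) : (r : Γ(Y, U)) = 0 := by
  have h0 : (r : Γ(Spec (CommRingCat.of R), ⊤)) = 0 := by
    rw [← map_natCast (Scheme.ΓSpecIso (.of R)).inv.hom r]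
    change (Scheme.ΓSpecIso (.of R)).inv.hom ((r : R)) = 0
    rw [hr, map_zero]
  rw [← map_natCast (f.appLE ⊤ U le_top).hom r, h0, map_zero]

/-- `(n • φ).app U = n • φ.app U` for morphisms of `𝒪`-modules. [folklore] -/
theorem nsmul_app {Y : Scheme.{u}} {M N : Y.Modules} (n : ℕ) (φ : M ⟶ N) (U : Y.Opens) :
    (n • φ).app U = n • φ.app U := by
  induction n with
  | zero => rw [zero_nsmul, zero_nsmul, Scheme.Modules.Hom.zero_app]
  | succ n ih => rw [succ_nsmul, succ_nsmul, Scheme.Modules.Hom.add_app, ih]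

/-- **`r · id_M = 0` on every `𝒪`-module `M` over an `R`-scheme when `r = 0` in `R`.** [folklore] -/
theorem nsmul_id_eq_zero_of_eq_zero {R : Type u} [CommRing R] {r : ℕ} (hr : (r : R) = 0)
    {Y : Scheme.{u}} (f : Y ⟶ Spec (.of R)) (M : Y.Modules) : r • (𝟙 M) = 0 := by
  apply Scheme.Modules.hom_ext
  intro U
  rw [nsmul_app, Scheme.Modules.Hom.zero_app, Scheme.Modules.Hom.id_app]
  ext x
  rw [AddCommGrpCat.hom_nsmul, AddCommGrpCat.hom_id, AddCommGrpCat.hom_zero,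
    AddMonoidHom.nsmul_apply, AddMonoidHom.id_apply, AddMonoidHom.zero_apply,
    ← Nat.cast_smul_eq_nsmul Γ(Y, U) r x, natCast_sections_eq_zero_of_eq_zero hr f U, zero_smul]

variable {p : ℕ} {k : Type u} [Field k] [CharP k p]

/-- Over a `k`-scheme (`k` of characteristic `p`), `p = 0` in every ring of sections. [folklore] -/
theorem natCast_sections_eq_zero {Y : Scheme.{u}} (f : Y ⟶ Spec (.of k)) (U : Y.Opens) :
    (p : Γ(Y, U)) = 0 :=
  natCast_sections_eq_zero_of_eq_zero (CharP.cast_eq_zero k p) f U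

/-- **`p · id = 0` on every `𝒪`-module over a `k`-scheme** (`char k = p`): every endomorphism `p · f`
of a module on a `W(k)`-scheme restricts to `0` on the special fibre. [folklore] -/
theorem nsmul_id_eq_zero {Y : Scheme.{u}} (f : Y ⟶ Spec (.of k)) (M : Y.Modules) :
    p • (𝟙 M) = 0 :=
  nsmul_id_eq_zero_of_eq_zero (CharP.cast_eq_zero k p) f M

/-- `pⁿ = 0` in `W_n(k) = W(k)/pⁿ`. [folklore] -/
theorem natCast_prime_pow_eq_zero_wittQuot (p : ℕ) [Fact p.Prime] (k : Type u) [CommRing k] (n : ℕ) :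
    ((p ^ n : ℕ) : wittQuot p k n) = 0 := by
  rw [Nat.cast_pow, ← map_natCast (Ideal.Quotient.mk (Ideal.span {(p : WittVector p k)} ^ n)) p,
    ← map_pow, Ideal.Quotient.eq_zero_iff_mem]
  exact Ideal.pow_mem_pow (Ideal.mem_span_singleton_self _) n

/-- **`pⁿ · id = 0` on every `𝒪`-module over the `n`-th thickening `X_n = 𝒳 ⊗ W/pⁿ`** of a
`W(k)`-scheme (any commutative ring `k`): the level-`n` analogue, for arguments along the `p`-adic
tower. [folklore] -/
theorem pow_nsmul_id_eq_zero_thickening {p : ℕ} [Fact p.Prime] {k : Type u} [CommRing k]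
    (𝒳 : SchemeOver (WittVector p k)) (n : ℕ) (M : (thickening 𝒳 n).left.Modules) :
    (p ^ n) • (𝟙 M) = 0 :=
  nsmul_id_eq_zero_of_eq_zero (natCast_prime_pow_eq_zero_wittQuot p k n) (thickening 𝒳 n).hom M

end CharP

section Free

variable {Y : Scheme.{u}}

/-- Finite local freeness is invariant under isomorphism. [folklore] -/
theorem isFiniteLocallyFree_of_iso {E E' : Y.Modules} (e : E ≅ E') (h : IsFiniteLocallyFree E) :
    IsFiniteLocallyFree E' := by
  intro x
  obtain ⟨U, hxU, I, hI, ⟨e₀⟩⟩ := h x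
  exact ⟨U, hxU, I, hI, ⟨e₀ ≪≫ (Scheme.Modules.overFunctor U).mapIso e⟩⟩

/-- `𝒪^I` is finite locally free for finite `I` (trivialised over `⊤`; tree `nonempty_pullbackFreeIso`).
[folklore] -/
theorem isFiniteLocallyFree_free (I : Type u) [Finite I] :
    IsFiniteLocallyFree (SheafOfModules.free (R := Y.ringCatSheaf) I : Y.Modules) := by
  refine isFiniteLocallyFree_of_restrict fun x ↦ ⟨⊤, trivial, I, inferInstance, ?_⟩
  obtain ⟨e⟩ := nonempty_pullbackFreeIso (⊤ : Y.Opens).ι I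
  exact ⟨e.symm ≪≫ ((Scheme.Modules.restrictFunctorIsoPullback (⊤ : Y.Opens).ι).app _).symm⟩

/-- The structure sheaf `𝒪_Y` as a module (`SheafOfModules.unit` `= free PUnit` up to Mathlib
`coproductUniqueIso`) is finite locally free, hence a vector bundle. [folklore] -/
theorem isFiniteLocallyFree_unit :
    IsFiniteLocallyFree (SheafOfModules.unit Y.ringCatSheaf : Y.Modules) :=
  isFiniteLocallyFree_of_iso
    (coproductUniqueIso (fun _ : PUnit.{u + 1} => (SheafOfModules.unit Y.ringCatSheaf : Y.Modules)))
    (isFiniteLocallyFree_free PUnit)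

end Free

section Witt

variable (p : ℕ) [Fact p.Prime] (k : Type) [CommRing k]

/-- `Spec W(k)` as a `W(k)`-scheme (identity structure map); it is proper over `W(k)` (and, on paper,
an `IsSmoothProperModel 0`, which is not needed). [folklore] -/
def specW : SchemeOver (WittVector p k) := Over.mk (𝟙 _)

/-- `Spec W(k) → Spec W(k)` is proper. [folklore] -/
instance isProper_specW_hom : IsProper (specW p k).hom := by
  change IsProper (𝟙 _)
  infer_instance

/-- The trivial line bundle `𝒪` on `Spec W(k)` (Mathlib `SheafOfModules.unit`). [folklore] -/
def trivialLine : (specW p k).left.Modules :=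
  (SheafOfModules.unit (specW p k).left.ringCatSheaf : (specW p k).left.Modules)

/-- `𝒪` on `Spec W(k)` is a vector bundle. [folklore] -/
theorem isVectorBundle_trivialLine : IsVectorBundle (trivialLine p k) :=
  isFiniteLocallyFree_unit.isVectorBundle

variable [CharP k p] [Nontrivial k]

/-- **On `Spec W(k)`, `p · id_𝒪 ≠ 0`**: evaluate on the global section `1` and use `p ≠ 0` in `W(k)`
(Mathlib `WittVector.p_nonzero`; `Γ(Spec W, 𝒪) ≅ W` by `Scheme.ΓSpecIso`). [folklore] -/
theorem nsmul_id_trivialLine_ne_zero : p • 𝟙 (trivialLine p k) ≠ 0 := by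
  intro h
  have h1 : (p • 𝟙 (trivialLine p k)).app ⊤ = (0 : trivialLine p k ⟶ trivialLine p k).app ⊤ := by
    rw [h]
  rw [nsmul_app, Scheme.Modules.Hom.id_app, Scheme.Modules.Hom.zero_app] at h1
  let s : Γ(trivialLine p k, ⊤) := show Γ((specW p k).left, ⊤) from 1
  have h2 := congrArg (fun ψ : Γ(trivialLine p k, ⊤) ⟶ Γ(trivialLine p k, ⊤) => ψ.hom s) h1
  simp only [AddCommGrpCat.hom_nsmul, AddCommGrpCat.hom_id, AddCommGrpCat.hom_zero,
    AddMonoidHom.nsmul_apply, AddMonoidHom.id_apply, AddMonoidHom.zero_apply] at h2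
  have h3 : (p : Γ(Spec (CommRingCat.of (WittVector p k)), ⊤)) = 0 := by
    rw [← nsmul_one]
    exact h2
  have h4 := congrArg (Scheme.ΓSpecIso (CommRingCat.of (WittVector p k))).hom.hom h3
  rw [map_natCast, map_zero] at h4
  exact WittVector.p_nonzero p k h4

end Witt

/-- **REFUTED strengthening: restriction of vector-bundle endomorphisms from a proper `W(k)`-scheme to
its special fibre is NOT faithful.** The refuted statement is the full-faithfulness half of formal GAGA
with the formal scheme replaced by `X_k`, in the `IsProper`-only format (all that the crux uses of
`IsSmoothProperModel`). Witness: `p = 2`, `k = 𝔽₂`, `𝒳 = Spec W(𝔽₂)` over itself, `F = 𝒪`, `f = 2·id`,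
`g = 0`: equal after restriction (`nsmul_id_eq_zero`), different on `𝒳` (`nsmul_id_trivialLine_ne_zero`).
[folklore] -/
theorem not_restrictSpecial_faithful :
    ¬ ∀ (p : ℕ) [Fact p.Prime] (k : Type) [Field k] [CharP k p] [PerfectRing k p]
        (𝒳 : SchemeOver (WittVector p k)), IsProper 𝒳.hom →
        ∀ (F : 𝒳.left.Modules), IsVectorBundle F → ∀ (f g : F ⟶ F),
          (Scheme.Modules.pullback (specialFibreι 𝒳)).map f =
            (Scheme.Modules.pullback (specialFibreι 𝒳)).map g → f = g := by
  intro H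
  haveI : Fact (Nat.Prime 2) := ⟨Nat.prime_two⟩
  refine nsmul_id_trivialLine_ne_zero 2 (ZMod 2) (H 2 (ZMod 2) (specW 2 (ZMod 2)) inferInstance
    (trivialLine 2 (ZMod 2)) (isVectorBundle_trivialLine 2 (ZMod 2)) _ _ ?_)
  rw [(Scheme.Modules.pullback _).map_nsmul, (Scheme.Modules.pullback _).map_id,
    (Scheme.Modules.pullback _).map_zero]
  exact nsmul_id_eq_zero (specialFibre (specW 2 (ZMod 2))).hom _

end

end Summit.HodgeConjecture.HodgeConjecture.Theorems.FormalVectorBundlesAlgebraize.Negative
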